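import Literature.IUT.LogVolume.GenuineLogThetaIdeles
import Literature.IUT.LogVolume.InitialThetaDataVolume
import Literature.IUT.HodgeTheaters.InitialThetaDataTorsionProofs
import Literature.NumberTheory.EllipticCurves.MultiplicativeReductionBaseChangeTorsionProofs
import HarnessLib

/-!
# The genuine Θ-volume input OF a collection of initial Θ-data EXISTS
# ([IUTchI] Def. 3.1 ⟹ Ex. 3.2 (iv), valuation half at `v̲ ∈ V̲^bad`; route D3 non-vacuity)

Proof-only companion (cell `abc-iut`, seat abc-iut-w5-d209) of abc-iut-S2's `InitialThetaDataVolume.lean`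
(the adapter `ThetaData.pilotData D`, `ThetaData.placeSection D`, `ThetaData.IsVolumeInputOf D I`) and
abc-iut-w4-d037's `GenuineLogThetaIdeles.lean` (`ThetaVolumeInput.exists_of_ordq`: the ideles of a genuine
Θ-volume input exist as soon as, at every bad place `v`, the valuation `ord_v(q_v)/(2l)` of `q̲_v = q_v^{1/2l}`
is attained in the completion `K_{v̲}`, i.e. `2l ∣ e(v̲|v)·ord_v(q_v)`). That divisibility is [IUTchI]
Example 3.2 (iv) (kurims May-2020 manuscript p. 71: "it follows from our assumption concerning `2`-torsion
[cf. Definition 3.1, (b)], together with the definition of `K` [cf. Definition 3.1, (c)], that `q_v` admits a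
`2l`-th root in `𝒪^▷(T_{X̲̲_v}) (≅ 𝒪^▷_{K_v̲})`") read at the level of valuations, and it is now a THEOREM of
the typed Def. 3.1 (abc-iut-L5-t2's `InitialThetaData`), assembled here from:
abc-iut-w5-d158's `two_mul_dvd_ordMinimalDiscriminant_baseChange_of_forall_smul_geomTorsion_eq`
(`E/F` multiplicative at `v`, `w ∣ v`, `w ∤ 2l`, `Γ_K` fixing `E_K[2]`, `E_K[l]` ⟹ `2l ∣ ord_w(Δ_min(E_K))`,
Silverman *ATAEC* V.6.1), abc-iut-L5-t2's `InitialThetaData.smul_geomTorsion_two_eq` / `…_l_eq` (Def. 3.1 (b)(c)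
⟹ `Γ_K` fixes `E_K[2]`, `E_K[l]`), abc-iut-S2's `ThetaData.hasMultiplicativeReductionAt_of_under` (Def. 3.1 (b)
⟹ `E_F` multiplicative below `V^bad_mod`), and Mathlib's ramification bookkeeping
(`valuation_liesOver`, `ramificationIdx'_algebra_tower'`).

* `ThetaData.natCast_not_mem_liftPlace`, `…two…`, `…l…` — `v̲ ∤ 2`, `v̲ ∤ l` at `v̲ = liftPlace D v`,
  `v ∈ V^bad_mod` (Def. 3.1 (b) "odd residue characteristic", (c) "`l` prime to the elements of `V^bad_mod`");
* `ThetaData.hasMultiplicativeReductionAt_baseChange_liftPlace` — `E_F ×_F K` has multiplicative reduction at `v̲`;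
* **`ThetaData.two_mul_l_dvd_ordMinimalDiscriminant_liftPlace`** — `2l ∣ ord_{v̲}(Δ_min(E_F ×_F K))`
  (`= ord_{v̲}(q_{v̲})`): [IUTchI] Ex. 3.2 (iv), valuation half, for initial Θ-data — no residual hypothesis;
* `ThetaData.ordMinimalDiscriminant_liftPlace_eq` — `ord_{v̲}(Δ_min(E_K)) = e(v̲|v)·ord_v(q_v)` with
  `ord_v(q_v) = −ord_v(j_E)` over `F_mod` (c312-3's `PilotData.ordq`);
* `ThetaData.exists_ordq_attained` — the divisibility datum `hq` of `ThetaVolumeInput.exists_of_ordq` for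
  `(pilotData D, placeSection D)`;
* **`ThetaData.exists_isVolumeInputOf`** — `∃ I : ThetaVolumeInput (fieldOfModuli E) K, IsVolumeInputOf D I`:
  the genuine Θ-volume input OF `D` exists, for EVERY collection of initial Θ-data `D` (non-vacuity of the
  hypothesis of `GenuineLogTheta`'s `−|log(Θ)|`, `−|log(q)|` "OF `D`" and of abc-iut-c312-8's
  `Cor312Prov.negAbsLogQ_eq_neg_absLogq_of_isVolumeInputOf`).

[cite: Mochizuki2012, IUTchI Def. 3.1 (b)(c) pp. 61–62, Ex. 3.2 (iv) p. 71] [cite: SilvermanATAEC1994, V.6 Prop. 6.1]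
[claim: Mochizuki2012, status: disputed] for every IUT quotation; the mathematics is classical; nothing is
asserted about [IUTchIII] Cor. 3.12 and no side is taken.
-/

noncomputable section

open scoped Classical

namespace Literature.IUT.LogVolume

namespace ThetaData

open Literature.IUT.HodgeTheaters NumberField IsDedekindDomain WeierstrassCurve

variable {F K Fbar : Type} [Field F] [NumberField F] [Field K] [NumberField K] [Algebra F K]
  [Field Fbar] [Algebra F Fbar] [Algebra K Fbar] {E : WeierstrassCurve F} [E.IsElliptic] {l : ℕ}
  {Pb : BadPlacePredicates K} (D : InitialThetaData F K Fbar E l Pb)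

/-! ## `v̲ ∤ 2`, `v̲ ∤ l` -/

/-- A natural number prime to the residue characteristic of `v ∈ V_mod` is not in `v̲` (`v̲ ∩ 𝓞_{F_mod} = v`).
[claim: Mochizuki2012, status: disputed] -/
theorem natCast_not_mem_liftPlace (v : HeightOneSpectrum (𝓞 (fieldOfModuli E))) {n : ℕ}
    (hn : ¬ Literature.IUT.HodgeTheaters.residueChar (FinitePlace.mk v) ∣ n) : ((n : ℕ) : 𝓞 K) ∉ (liftPlace D v).asIdeal := by
  intro hmem
  apply hn
  -- pull back to `v`: `(n : 𝓞_{F_mod}) ∈ v`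
  have hv : ((n : ℕ) : 𝓞 (fieldOfModuli E)) ∈ v.asIdeal := by
    have h := ((placeSection D).algebraMap_mem_lift_iff v ((n : ℕ) : 𝓞 (fieldOfModuli E))).mp
    rw [map_natCast] at h
    exact h hmem
  -- hence `n = 0` in the residue ring, whose characteristic is the residue characteristic of `v`
  have h0 : ((n : ℕ) : 𝓞 (fieldOfModuli E) ⧸ v.asIdeal) = 0 := by
    rw [← map_natCast (Ideal.Quotient.mk v.asIdeal), Ideal.Quotient.eq_zero_iff_mem]
    exact hv
  have hchar := (ringChar.spec (𝓞 (fieldOfModuli E) ⧸ v.asIdeal) n).mp h0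
  unfold Literature.IUT.HodgeTheaters.residueChar
  rwa [FinitePlace.maximalIdeal_mk]

/-- The residue ring `𝓞_{F_mod}/v` has characteristic `≠ 1`. [folklore] -/
private theorem residueChar_mk_ne_one (v : HeightOneSpectrum (𝓞 (fieldOfModuli E))) :
    Literature.IUT.HodgeTheaters.residueChar (FinitePlace.mk v) ≠ 1 := by
  unfold Literature.IUT.HodgeTheaters.residueChar
  rw [FinitePlace.maximalIdeal_mk]
  haveI : Nontrivial (𝓞 (fieldOfModuli E) ⧸ v.asIdeal) := Ideal.Quotient.nontrivial_iff.mpr v.isPrime.ne_top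
  exact CharP.ringChar_ne_one

/-- **`v̲ ∤ 2` for `v ∈ V^bad_mod`** (Def. 3.1 (b): "`V^bad_mod` … of odd residue characteristic").
[claim: Mochizuki2012, status: disputed] -/
theorem two_not_mem_liftPlace {v : HeightOneSpectrum (𝓞 (fieldOfModuli E))} (hv : v ∈ badPrimesMod D) :
    (2 : 𝓞 K) ∉ (liftPlace D v).asIdeal := by
  have h := natCast_not_mem_liftPlace D v (n := 2) (by
    intro hd
    have hodd := D.VbadMod_odd (FinitePlace.mk v) ((mem_badPrimesMod_iff D v).mp hv)
    rcases (Nat.dvd_prime Nat.prime_two).mp hd with h1 | h2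
    · exact residueChar_mk_ne_one v h1
    · rw [h2] at hodd
      exact (Nat.not_odd_iff_even.mpr even_two) hodd)
  exact_mod_cast h

/-- **`v̲ ∤ l` for `v ∈ V^bad_mod`** (Def. 3.1 (c): "`l` is prime to the elements of `V^bad_mod`").
[claim: Mochizuki2012, status: disputed] -/
theorem l_not_mem_liftPlace {v : HeightOneSpectrum (𝓞 (fieldOfModuli E))} (hv : v ∈ badPrimesMod D) :
    (l : 𝓞 K) ∉ (liftPlace D v).asIdeal :=
  natCast_not_mem_liftPlace D v (n := l) (by
    intro hd
    have hne := D.l_ne_residueChar (FinitePlace.mk v) ((mem_badPrimesMod_iff D v).mp hv)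
    rcases (Nat.dvd_prime D.l_prime).mp hd with h1 | h2
    · exact residueChar_mk_ne_one v h1
    · exact hne h2)

/-! ## Multiplicative reduction of `E_F ×_F K` at `v̲`, and `2l ∣ ord_{v̲}(Δ_min)` -/

omit [NumberField F] [NumberField K] in
/-- The place of `F` below `v̲` lies below `v̲` (Mathlib `LiesOver`). [folklore] -/
private theorem liesOver_under_F (w : HeightOneSpectrum (𝓞 K)) :
    w.asIdeal.LiesOver (w.under (𝓞 F)).asIdeal := ⟨rfl⟩

/-- The place of `F` below `v̲ = liftPlace D v` lies over `v` (`v̲ ∩ 𝓞_{F_mod} = v`, S2's `under_liftPlace`).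
[claim: Mochizuki2012, status: disputed] -/
theorem under_under_liftPlace (v : HeightOneSpectrum (𝓞 (fieldOfModuli E))) :
    ((liftPlace D v).under (𝓞 F)).under (𝓞 (fieldOfModuli E)) = v := by
  apply HeightOneSpectrum.ext
  rw [HeightOneSpectrum.under_asIdeal, HeightOneSpectrum.under_asIdeal, Ideal.under_under,
    ← HeightOneSpectrum.under_asIdeal, under_liftPlace D v]

/-- **`E_F ×_F K` has multiplicative reduction at `v̲ ∈ V̲^bad`**: `E_F` is multiplicative at the place of `F`
below `v̲` (Def. 3.1 (b), S2's `hasMultiplicativeReductionAt_of_under`), and multiplicative reduction survives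
the base change to `K` because `Γ_K` fixes `E_K[l]` pointwise (`l ≥ 5`, `v̲ ∤ l`; w5-d158 / Raynaud,
[IUTchIV] Prop. 1.8 (v)). [claim: Mochizuki2012, status: disputed] -/
theorem hasMultiplicativeReductionAt_baseChange_liftPlace {v : HeightOneSpectrum (𝓞 (fieldOfModuli E))}
    (hv : v ∈ badPrimesMod D) : (E.baseChange K).HasMultiplicativeReductionAt (liftPlace D v) := by
  haveI := liesOver_under_F (F := F) (liftPlace D v)
  have hmult : E.HasMultiplicativeReductionAt ((liftPlace D v).under (𝓞 F)) :=
    hasMultiplicativeReductionAt_of_under D hv (under_under_liftPlace D v)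
  have hl3 : 3 ≤ l := by have := D.five_le_l; omega
  exact E.hasMultiplicativeReductionAt_baseChange_of_forall_smul_geomTorsion_eq hmult D.l_prime hl3
    (l_not_mem_liftPlace D hv) (D.smul_geomTorsion_l_eq)

/-- **[IUTchI] Example 3.2 (iv), valuation half, for initial Θ-data: `2l ∣ ord_{v̲}(Δ_min(E_F ×_F K))`**
(`= ord_{v̲}(q_{v̲})`) at every `v̲ = liftPlace D v`, `v ∈ V^bad_mod` — "from our assumption concerning
`2`-torsion [Def. 3.1 (b)], together with the definition of `K` [Def. 3.1 (c)]" (p. 71): w5-d158's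
`two_mul_dvd_ordMinimalDiscriminant_baseChange_of_forall_smul_geomTorsion_eq` with L5-t2's Galois bridge
`smul_geomTorsion_two_eq` / `smul_geomTorsion_l_eq` and `v̲ ∤ 2`, `v̲ ∤ l` from Def. 3.1 (b)(c). No residual.
[claim: Mochizuki2012, status: disputed] -/
theorem two_mul_l_dvd_ordMinimalDiscriminant_liftPlace {v : HeightOneSpectrum (𝓞 (fieldOfModuli E))}
    (hv : v ∈ badPrimesMod D) : 2 * l ∣ (E.baseChange K).ordMinimalDiscriminant (liftPlace D v) := by
  haveI := liesOver_under_F (F := F) (liftPlace D v)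
  have hmult : E.HasMultiplicativeReductionAt ((liftPlace D v).under (𝓞 F)) :=
    hasMultiplicativeReductionAt_of_under D hv (under_under_liftPlace D v)
  have hl2 : l ≠ 2 := by have := D.five_le_l; omega
  exact E.two_mul_dvd_ordMinimalDiscriminant_baseChange_of_forall_smul_geomTorsion_eq hmult D.l_prime hl2
    (two_not_mem_liftPlace D hv) (l_not_mem_liftPlace D hv) (D.smul_geomTorsion_two_eq) (D.smul_geomTorsion_l_eq)

/-! ## `ord_{v̲}(Δ_min(E_K)) = e(v̲|v)·ord_v(q_v)` and the divisibility datum `hq` -/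

/-- `v̲` lies over `v`. [claim: Mochizuki2012, status: disputed] -/
theorem liesOver_liftPlace (v : HeightOneSpectrum (𝓞 (fieldOfModuli E))) :
    (liftPlace D v).asIdeal.LiesOver v.asIdeal :=
  (placeSection D).liesOver_lift v

/-- **`ord_{v̲}(Δ_min(E_K)) = e(v̲|v) · ord_v(q_v)`** with `ord_v(q_v) := −ord_v(j_E)` over `F_mod` (c312-3's
`PilotData.ordq` of S2's `pilotData D`): at the multiplicative place `v̲`, `ord_{v̲}(Δ_min(E_K)) = −ord_{v̲}(j)`
(Silverman *AEC* VII.5.1 (b), tree `log_valuation_j_eq_ordMinimalDiscriminant_of_hasMultiplicativeReductionAt`)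
and `ord_{v̲}(j) = e(v̲|v)·ord_v(j_E)` (Mathlib `valuation_liesOver`). [claim: Mochizuki2012, status: disputed] -/
theorem ordMinimalDiscriminant_liftPlace_eq {v : HeightOneSpectrum (𝓞 (fieldOfModuli E))}
    (hv : v ∈ badPrimesMod D) :
    ((E.baseChange K).ordMinimalDiscriminant (liftPlace D v) : ℤ) =
      (v.asIdeal.ramificationIdx' (liftPlace D v).asIdeal : ℤ) * (pilotData D).ordq v := by
  haveI := liesOver_liftPlace D v
  haveI : (E.baseChange K).IsElliptic := inferInstanceAs (E.map (algebraMap F K)).IsElliptic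
  have hmultK := hasMultiplicativeReductionAt_baseChange_liftPlace D hv
  rw [← (E.baseChange K).log_valuation_j_eq_ordMinimalDiscriminant_of_hasMultiplicativeReductionAt _ hmultK]
  have hj : (E.baseChange K).j = algebraMap (fieldOfModuli E) K (jMod E) := by
    rw [show (E.baseChange K).j = algebraMap F K E.j from E.map_j _, ← algebraMap_jMod E,
      ← IsScalarTower.algebraMap_apply]
  rw [hj, ← IsDedekindDomain.HeightOneSpectrum.valuation_liesOver K v (liftPlace D v) (jMod E),
    WithZero.log_pow]
  unfold PilotData.ordq
  rw [pilotData_jE]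
  unfold ord
  ring

/-- `e(v̲|p) = e(v|p) · e(v̲|v)` in the tower `ℤ ⊆ 𝓞_{F_mod} ⊆ 𝓞_K` (Mathlib `ramificationIdx'_algebra_tower'`),
with `e(v|p)` = c312-3's `ramIdx` and `e(v̲|p)` = Mathlib's `Ideal.ramificationIdx _ ℤ`. [folklore] -/
private theorem ramificationIdx_liftPlace_eq (v : HeightOneSpectrum (𝓞 (fieldOfModuli E))) :
    ((liftPlace D v).asIdeal.ramificationIdx ℤ : ℕ) =
      ramIdx (fieldOfModuli E) v * v.asIdeal.ramificationIdx' (liftPlace D v).asIdeal := by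
  haveI := liesOver_liftPlace D v
  haveI : (liftPlace D v).asIdeal.LiesOver (Ideal.span {(residueChar (fieldOfModuli E) v : ℤ)}) :=
    Ideal.LiesOver.trans (liftPlace D v).asIdeal v.asIdeal _
  have hp : Ideal.span {(residueChar (fieldOfModuli E) v : ℤ)} ≠ ⊥ := by
    rw [Ne, Ideal.span_singleton_eq_bot]
    exact_mod_cast (residueChar_prime (fieldOfModuli E) v).ne_zero
  rw [← Ideal.ramificationIdx'_eq_ramificationIdx (Ideal.span {(residueChar (fieldOfModuli E) v : ℤ)})
    (liftPlace D v).asIdeal hp]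
  unfold ramIdx
  exact Ideal.ramificationIdx'_algebra_tower' _ _ _

/-- **The divisibility datum `hq` of `ThetaVolumeInput.exists_of_ordq` for initial Θ-data**: at every
`v ∈ V^bad_mod`, `ord_v(q_v)/(2l)` is attained in `K_{v̲}`, i.e. `∃ n : ℤ, n·e_v/e_{v̲} = ord_v(q_v)/(2l)`
(`n := ord_{v̲}(Δ_min(E_K))/(2l) ∈ ℤ` by `two_mul_l_dvd_ordMinimalDiscriminant_liftPlace`).
[claim: Mochizuki2012, status: disputed] -/
theorem exists_ordq_attained (v : HeightOneSpectrum (𝓞 (fieldOfModuli E))) (hv : v ∈ (pilotData D).S) :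
    ∃ n : ℤ, (n : ℝ) * (ramIdx (fieldOfModuli E) v : ℝ) /
        (((placeSection D).lift v).asIdeal.ramificationIdx ℤ : ℝ) =
      ((pilotData D).ordq v : ℝ) / (2 * (pilotData D).l) := by
  rw [pilotData_S] at hv
  rw [placeSection_lift, pilotData_l]
  haveI := liesOver_liftPlace D v
  obtain ⟨n, hn⟩ := two_mul_l_dvd_ordMinimalDiscriminant_liftPlace D hv
  have hM := ordMinimalDiscriminant_liftPlace_eq D hv
  rw [hn] at hM
  push_cast at hM
  have he : (v.asIdeal.ramificationIdx' (liftPlace D v).asIdeal : ℝ) ≠ 0 := by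
    exact_mod_cast Ideal.IsDedekindDomain.ramificationIdx'_ne_zero_of_liesOver (liftPlace D v).asIdeal v.ne_bot
  have hr : (ramIdx (fieldOfModuli E) v : ℝ) ≠ 0 := by
    haveI : Fact (residueChar (fieldOfModuli E) v).Prime := ⟨residueChar_prime (fieldOfModuli E) v⟩
    have hp : Ideal.span {(residueChar (fieldOfModuli E) v : ℤ)} ≠ ⊥ := by
      rw [Ne, Ideal.span_singleton_eq_bot]
      exact_mod_cast (residueChar_prime (fieldOfModuli E) v).ne_zero
    unfold ramIdx
    exact_mod_cast Ideal.IsDedekindDomain.ramificationIdx'_ne_zero_of_liesOver v.asIdeal hp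
  have hl : (l : ℝ) ≠ 0 := by exact_mod_cast D.l_prime.ne_zero
  refine ⟨n, ?_⟩
  rw [ramificationIdx_liftPlace_eq D v]
  push_cast
  have hMR : (2 * (l : ℝ)) * n = (v.asIdeal.ramificationIdx' (liftPlace D v).asIdeal : ℝ) *
      ((pilotData D).ordq v : ℝ) := by exact_mod_cast hM
  field_simp
  linear_combination hMR

/-- **The genuine Θ-volume input OF `D` exists**: for every collection of initial Θ-data `D` there is
`I : ThetaVolumeInput (fieldOfModuli E) K` with `IsVolumeInputOf D I` (S2's predicate: `I`'s pilot data and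
section are `D`'s). Hence abc-iut-S2's DEFINED `−|log(Θ)|`, `−|log(q)|` "OF `D`" and every theorem hypothesising
an input OF `D` (e.g. abc-iut-c312-8's `Cor312Prov.negAbsLogQ_eq_neg_absLogq_of_isVolumeInputOf`) are
non-vacuous — w4-d037's `ThetaVolumeInput.exists_of_ordq` with `exists_ordq_attained`.
[claim: Mochizuki2012, status: disputed] -/
theorem exists_isVolumeInputOf :
    ∃ I : ThetaVolumeInput (fieldOfModuli E) K, IsVolumeInputOf D I := by
  obtain ⟨I, h₁, h₂⟩ :=
    ThetaVolumeInput.exists_of_ordq (pilotData D) (placeSection D) (fun v hv => exists_ordq_attained D v hv)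
  exact ⟨I, ⟨h₁, h₂⟩⟩

end ThetaData

end Literature.IUT.LogVolume

end
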